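import Mathlib
import Literature.Analysis.Complex.HolomorphicParametricIntegral
import Literature.NumberTheory.LFunctions.DeBruijnNewmanProofs
import HarnessLib

/-!
# Radial rigidity of cone-represented kernels, part I: the complexified latitude integral

Helper file for the registered stub `stub_radialRigidity` of the line `cluster-light-cone` of the
crux `ClusterSetTotallyDisconnected` (stmt-CriticalPhenomena-4659).  Model-blind measure theory /
complex analysis on a measure `μ` on `ℝ² × ℝ ∋ (k, ω)` carried by the forward cone `{ω ≥ ‖k‖}`
(`μ {ω < ‖k‖} = 0`) whose Laplace transforms `∫ e^{-ωτ} dμ` are finite for `τ > 0`.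

For `s > 0`, `c ∈ ℝ` the latitude circle `θ ↦ (s sin θ, c, s cos θ)` about the `e₁`-axis of a
kernel with the unit-cone Källén–Lehmann representation
`K(u, v, t) = ∫ cos(k₀ u + k₁ v) e^{-ω|t|} dμ` (`t ≠ 0`) is, where `cos θ > 0`, the real trace of

  `G(ψ) = ∫ cos(k₀ s sin ψ + k₁ c) · e^{-ω s cos ψ} dμ(k, ω)`.

We prove: the integrand is bounded by `e^{-ω s cos(Re ψ) e^{-|Im ψ|}}` on the cone
(`norm_latitudeIntegrand_le`; `|cos w| ≤ e^{|Im w|}` is the tree's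
`Literature.NumberTheory.LFunctions.norm_cos_le_exp_abs_im`, `Im sin ψ = cos α sinh β`,
`Re cos ψ = cos α cosh β`, `cosh β - |sinh β| = e^{-|β|}`), hence `G` is holomorphic on the
vertical half-strips `{cos(Re ψ) > 0}` (`differentiableOn_latitudeExt`, dominated holomorphic
parameter integral `Literature.Analysis.Complex.differentiableOn_integral_of_dominated`), obeys
`‖G(α + iβ)‖ ≤ ∫ e^{-ω s cos α e^{-|β|}} dμ` (`norm_latitudeExt_le`) and is real with the
Källén–Lehmann value at real points (`latitudeExt_ofReal`).  No definitions.
-/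

namespace Summit.CriticalPhenomena.Ising3DConformalLimit.Cruxes.ClusterSetTotallyDisconnected.ClusterLightCone.RadialRigidity

open MeasureTheory Complex Set Filter Metric
open scoped Topology

/-- `cosh β - |sinh β| = e^{-|β|}`. [folklore] -/
theorem cosh_sub_abs_sinh (β : ℝ) : Real.cosh β - |Real.sinh β| = Real.exp (-|β|) := by
  rw [Real.abs_sinh, ← Real.cosh_abs β, Real.cosh_sub_sinh]

/-- `Im (k₀ s sin ψ + k₁ c) = k₀ s cos(Re ψ) sinh(Im ψ)` for real `k₀, k₁, s, c`. [folklore] -/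
theorem im_cosArg (k₀ k₁ s c : ℝ) (ψ : ℂ) :
    ((k₀ : ℂ) * ((s : ℂ) * Complex.sin ψ) + (k₁ : ℂ) * (c : ℂ)).im =
      k₀ * s * (Real.cos ψ.re * Real.sinh ψ.im) := by
  rw [Complex.sin_eq]
  simp [Complex.cosh_ofReal_re, Complex.sinh_ofReal_re, Complex.cos_ofReal_re, Complex.sin_ofReal_re,
    Complex.cosh_ofReal_im, Complex.sinh_ofReal_im, Complex.cos_ofReal_im, Complex.sin_ofReal_im]
  ring

/-- `Re (-(ω s cos ψ)) = -ω s cos(Re ψ) cosh(Im ψ)` for real `ω, s`. [folklore] -/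
theorem re_expArg (ω s : ℝ) (ψ : ℂ) :
    (-((ω : ℂ) * ((s : ℂ) * Complex.cos ψ))).re = -(ω * s * (Real.cos ψ.re * Real.cosh ψ.im)) := by
  rw [Complex.cos_eq]
  simp [Complex.cosh_ofReal_re, Complex.sinh_ofReal_re, Complex.cos_ofReal_re, Complex.sin_ofReal_re,
    Complex.cosh_ofReal_im, Complex.sinh_ofReal_im, Complex.cos_ofReal_im, Complex.sin_ofReal_im]
  ring

/-- **Pointwise bound of the complexified latitude integrand on the cone.**  For `‖k‖ ≤ ω`,
`s ≥ 0` and `cos(Re ψ) > 0`: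
`|cos(k₀ s sin ψ + k₁ c) e^{-ω s cos ψ}| ≤ e^{-ω s cos(Re ψ) e^{-|Im ψ|}}`. [folklore] -/
theorem norm_latitudeIntegrand_le {s : ℝ} (hs : 0 ≤ s) (c : ℝ) {ψ : ℂ} (hψ : 0 < Real.cos ψ.re)
    {p : EuclideanSpace ℝ (Fin 2) × ℝ} (hp : ‖p.1‖ ≤ p.2) :
    ‖Complex.cos (↑(p.1 0) * (↑s * Complex.sin ψ) + ↑(p.1 1) * ↑c) *
        Complex.exp (-(↑p.2 * (↑s * Complex.cos ψ)))‖ ≤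
      Real.exp (-(p.2 * (s * Real.cos ψ.re * Real.exp (-|ψ.im|)))) := by
  have h0 : |p.1 0| ≤ p.2 := by
    have h := PiLp.norm_apply_le p.1 0
    rw [Real.norm_eq_abs] at h
    exact h.trans hp
  rw [norm_mul, Complex.norm_exp, re_expArg, ← cosh_sub_abs_sinh]
  have hcos := Literature.NumberTheory.LFunctions.norm_cos_le_exp_abs_im
    (↑(p.1 0) * (↑s * Complex.sin ψ) + ↑(p.1 1) * ↑c)
  rw [im_cosArg] at hcos
  have habs : |p.1 0 * s * (Real.cos ψ.re * Real.sinh ψ.im)| =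
      |p.1 0| * (s * Real.cos ψ.re * |Real.sinh ψ.im|) := by
    rw [abs_mul, abs_mul, abs_mul, abs_of_nonneg hs, abs_of_pos hψ]
    ring
  rw [habs] at hcos
  have key : |p.1 0| * (s * Real.cos ψ.re * |Real.sinh ψ.im|) ≤
      p.2 * (s * Real.cos ψ.re * |Real.sinh ψ.im|) :=
    mul_le_mul_of_nonneg_right h0 (by positivity)
  calc ‖Complex.cos (↑(p.1 0) * (↑s * Complex.sin ψ) + ↑(p.1 1) * ↑c)‖ *
        Real.exp (-(p.2 * s * (Real.cos ψ.re * Real.cosh ψ.im)))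
      ≤ Real.exp (|p.1 0| * (s * Real.cos ψ.re * |Real.sinh ψ.im|)) *
          Real.exp (-(p.2 * s * (Real.cos ψ.re * Real.cosh ψ.im))) := by gcongr
    _ ≤ Real.exp (-(p.2 * (s * Real.cos ψ.re * (Real.cosh ψ.im - |Real.sinh ψ.im|)))) := by
        rw [← Real.exp_add]
        refine Real.exp_le_exp.2 ?_
        nlinarith [key]

/-- Cone support almost everywhere: `‖k‖ ≤ ω` for `μ`-a.e. `(k, ω)`. [folklore] -/
theorem ae_norm_fst_le_snd {μ : Measure (EuclideanSpace ℝ (Fin 2) × ℝ)}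
    (hcone : μ {p : EuclideanSpace ℝ (Fin 2) × ℝ | p.2 < ‖p.1‖} = 0) :
    ∀ᵐ p ∂μ, ‖p.1‖ ≤ p.2 := by
  have h : ∀ᵐ p ∂μ, p ∉ {p : EuclideanSpace ℝ (Fin 2) × ℝ | p.2 < ‖p.1‖} :=
    measure_eq_zero_iff_ae_notMem.1 hcone
  filter_upwards [h] with p hp
  simpa using hp

/-- The complexified latitude integrand is continuous in the integration variable. [folklore] -/
theorem continuous_latitudeIntegrand (s c : ℝ) (ψ : ℂ) :
    Continuous fun p : EuclideanSpace ℝ (Fin 2) × ℝ =>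
      Complex.cos (↑(p.1 0) * (↑s * Complex.sin ψ) + ↑(p.1 1) * ↑c) *
        Complex.exp (-(↑p.2 * (↑s * Complex.cos ψ))) := by
  fun_prop

/-- The complexified latitude integrand is entire in the parameter `ψ`. [folklore] -/
theorem differentiable_latitudeIntegrand (s c : ℝ) (p : EuclideanSpace ℝ (Fin 2) × ℝ) :
    Differentiable ℂ fun ψ : ℂ =>
      Complex.cos (↑(p.1 0) * (↑s * Complex.sin ψ) + ↑(p.1 1) * ↑c) *
        Complex.exp (-(↑p.2 * (↑s * Complex.cos ψ))) := by
  fun_prop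

/-- The half-strips `{cos(Re ψ) > 0}` form an open set. [folklore] -/
theorem isOpen_setOf_cos_re_pos : IsOpen {ψ : ℂ | 0 < Real.cos ψ.re} :=
  isOpen_lt continuous_const (Real.continuous_cos.comp Complex.continuous_re)

/-- **Uniform majorant near a point.**  Around `ψ₀` with `cos(Re ψ₀) > 0` there is a ball on which
`cos(Re ψ) e^{-|Im ψ|}` stays above the positive constant `(cos(Re ψ₀)/2) e^{-(|Im ψ₀| + 1)}`.
[folklore] -/
theorem exists_ball_cos_re_mul_exp_ge {ψ₀ : ℂ} (hψ₀ : 0 < Real.cos ψ₀.re) :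
    ∃ R : ℝ, 0 < R ∧ ∀ ψ ∈ ball ψ₀ R, Real.cos ψ₀.re / 2 < Real.cos ψ.re ∧
      Real.cos ψ₀.re / 2 * Real.exp (-(|ψ₀.im| + 1)) ≤ Real.cos ψ.re * Real.exp (-|ψ.im|) := by
  have hV : IsOpen {ψ : ℂ | Real.cos ψ₀.re / 2 < Real.cos ψ.re ∧ |ψ.im| < |ψ₀.im| + 1} :=
    (isOpen_lt continuous_const (Real.continuous_cos.comp Complex.continuous_re)).inter
      (isOpen_lt (continuous_abs.comp Complex.continuous_im) continuous_const)
  have hmem : ψ₀ ∈ {ψ : ℂ | Real.cos ψ₀.re / 2 < Real.cos ψ.re ∧ |ψ.im| < |ψ₀.im| + 1} := by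
    refine ⟨?_, ?_⟩
    · show Real.cos ψ₀.re / 2 < Real.cos ψ₀.re
      linarith
    · show |ψ₀.im| < |ψ₀.im| + 1
      linarith
  obtain ⟨R, hR, hball⟩ := Metric.isOpen_iff.1 hV ψ₀ hmem
  refine ⟨R, hR, fun ψ hψ => ?_⟩
  obtain ⟨h1, h2⟩ := hball hψ
  refine ⟨h1, ?_⟩
  have h3 : Real.exp (-(|ψ₀.im| + 1)) ≤ Real.exp (-|ψ.im|) := Real.exp_le_exp.2 (by linarith)
  have h4 : 0 ≤ Real.cos ψ₀.re / 2 := by linarith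
  calc Real.cos ψ₀.re / 2 * Real.exp (-(|ψ₀.im| + 1))
      ≤ Real.cos ψ₀.re / 2 * Real.exp (-|ψ.im|) := by gcongr
    _ ≤ Real.cos ψ.re * Real.exp (-|ψ.im|) := by gcongr

/-- **Holomorphy of the complexified latitude integral.**  If `μ` is carried by the cone
`{ω ≥ ‖k‖}` and `∫ e^{-ωτ} dμ < ∞` for every `τ > 0`, then for `s > 0`
`ψ ↦ ∫ cos(k₀ s sin ψ + k₁ c) e^{-ω s cos ψ} dμ` is holomorphic on `{cos(Re ψ) > 0}`
(dominated holomorphic parameter integral). [folklore] -/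
theorem differentiableOn_latitudeExt {μ : Measure (EuclideanSpace ℝ (Fin 2) × ℝ)}
    (hcone : μ {p : EuclideanSpace ℝ (Fin 2) × ℝ | p.2 < ‖p.1‖} = 0)
    (hint : ∀ τ : ℝ, 0 < τ → Integrable (fun p : EuclideanSpace ℝ (Fin 2) × ℝ => Real.exp (-(p.2 * τ))) μ)
    {s : ℝ} (hs : 0 < s) (c : ℝ) :
    DifferentiableOn ℂ (fun ψ : ℂ => ∫ p : EuclideanSpace ℝ (Fin 2) × ℝ,
      Complex.cos (↑(p.1 0) * (↑s * Complex.sin ψ) + ↑(p.1 1) * ↑c) *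
        Complex.exp (-(↑p.2 * (↑s * Complex.cos ψ))) ∂μ) {ψ : ℂ | 0 < Real.cos ψ.re} := by
  refine Literature.Analysis.Complex.differentiableOn_integral_of_dominated
    (fun ψ _ => (continuous_latitudeIntegrand s c ψ).aestronglyMeasurable)
    (Eventually.of_forall fun p => (differentiable_latitudeIntegrand s c p).differentiableOn) ?_
  intro ψ₀ hψ₀
  obtain ⟨R, hR, hball⟩ := exists_ball_cos_re_mul_exp_ge (ψ₀ := ψ₀) hψ₀
  have hδ : 0 < s * (Real.cos ψ₀.re / 2 * Real.exp (-(|ψ₀.im| + 1))) := by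
    have : 0 < Real.cos ψ₀.re / 2 := by simp only [mem_setOf_eq] at hψ₀; linarith
    positivity
  refine ⟨R, hR, fun ψ hψ => ?_, fun p => Real.exp (-(p.2 * (s * (Real.cos ψ₀.re / 2 *
    Real.exp (-(|ψ₀.im| + 1)))))), hint _ hδ, ?_⟩
  · have := (hball ψ hψ).1
    simp only [mem_setOf_eq] at hψ₀ ⊢
    linarith
  · filter_upwards [ae_norm_fst_le_snd hcone] with p hp ψ hψ
    obtain ⟨h1, h2⟩ := hball ψ hψ
    have hψpos : 0 < Real.cos ψ.re := by simp only [mem_setOf_eq] at hψ₀; linarith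
    have hp2 : 0 ≤ p.2 := (norm_nonneg _).trans hp
    refine (norm_latitudeIntegrand_le hs.le c hψpos hp).trans (Real.exp_le_exp.2 ?_)
    have : p.2 * (s * (Real.cos ψ₀.re / 2 * Real.exp (-(|ψ₀.im| + 1)))) ≤
        p.2 * (s * Real.cos ψ.re * Real.exp (-|ψ.im|)) := by
      have h3 : s * (Real.cos ψ₀.re / 2 * Real.exp (-(|ψ₀.im| + 1))) ≤
          s * Real.cos ψ.re * Real.exp (-|ψ.im|) := by
        rw [mul_assoc]
        exact mul_le_mul_of_nonneg_left h2 hs.le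
      exact mul_le_mul_of_nonneg_left h3 hp2
    linarith

/-- **Growth of the complexified latitude integral**: for `cos(Re ψ) > 0`,
`‖∫ cos(k₀ s sin ψ + k₁ c) e^{-ω s cos ψ} dμ‖ ≤ ∫ e^{-ω · s cos(Re ψ) e^{-|Im ψ|}} dμ`. [folklore] -/
theorem norm_latitudeExt_le {μ : Measure (EuclideanSpace ℝ (Fin 2) × ℝ)}
    (hcone : μ {p : EuclideanSpace ℝ (Fin 2) × ℝ | p.2 < ‖p.1‖} = 0)
    (hint : ∀ τ : ℝ, 0 < τ → Integrable (fun p : EuclideanSpace ℝ (Fin 2) × ℝ => Real.exp (-(p.2 * τ))) μ)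
    {s : ℝ} (hs : 0 < s) (c : ℝ) {ψ : ℂ} (hψ : 0 < Real.cos ψ.re) :
    ‖∫ p : EuclideanSpace ℝ (Fin 2) × ℝ,
      Complex.cos (↑(p.1 0) * (↑s * Complex.sin ψ) + ↑(p.1 1) * ↑c) *
        Complex.exp (-(↑p.2 * (↑s * Complex.cos ψ))) ∂μ‖ ≤
      ∫ p : EuclideanSpace ℝ (Fin 2) × ℝ, Real.exp (-(p.2 * (s * Real.cos ψ.re * Real.exp (-|ψ.im|)))) ∂μ := by
  refine norm_integral_le_of_norm_le (hint _ (by positivity)) ?_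
  filter_upwards [ae_norm_fst_le_snd hcone] with p hp
  exact norm_latitudeIntegrand_le hs.le c hψ hp

/-- **Real points**: for real `θ` with `cos θ > 0` (and `s ≥ 0`) the complexified latitude integral
is the real Källén–Lehmann integral `∫ cos(k₀ s sin θ + k₁ c) e^{-ω |s cos θ|} dμ`. [folklore] -/
theorem latitudeExt_ofReal {μ : Measure (EuclideanSpace ℝ (Fin 2) × ℝ)} {s : ℝ} (hs : 0 ≤ s) (c : ℝ)
    {θ : ℝ} (hθ : 0 < Real.cos θ) :
    (∫ p : EuclideanSpace ℝ (Fin 2) × ℝ,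
      Complex.cos (↑(p.1 0) * (↑s * Complex.sin (θ : ℂ)) + ↑(p.1 1) * ↑c) *
        Complex.exp (-(↑p.2 * (↑s * Complex.cos (θ : ℂ)))) ∂μ) =
      ((∫ p : EuclideanSpace ℝ (Fin 2) × ℝ,
        Real.cos (p.1 0 * (s * Real.sin θ) + p.1 1 * c) * Real.exp (-(p.2 * |s * Real.cos θ|)) ∂μ : ℝ) : ℂ) := by
  rw [← integral_complex_ofReal]
  refine integral_congr_ae (Eventually.of_forall fun p => ?_)
  rw [abs_of_nonneg (mul_nonneg hs hθ.le)]
  push_cast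
  ring_nf

end Summit.CriticalPhenomena.Ising3DConformalLimit.Cruxes.ClusterSetTotallyDisconnected.ClusterLightCone.RadialRigidity
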